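import Mathlib
import Summits.NavierStokesRegularity.NavierStokesRegularity.Theorems.TaoLadderRungTwoBreakOneShiftWindowSensGlue
import HarnessLib

/-!
# One-shift window certificate, kernel side — part LXXI: THE FLIGHT-TIME LIPSCHITZ CLAUSE `hZedge` (left-behind
# shell `0`) FROM THE TWO-RUN SENSITIVITY CHAIN plus the TIME part (the field hull of the final step times the
# flight-time difference `≤ r_τ · dist`) (cell harvest/h2-tao-ladder, seat p2;
# rung1/RUNG1-P2G16-REPORT.md §83 (K2); support for K1(1) = `NoSurvivingDSSOne`, stmt-NavierStokesRegularity-20205)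

MODEL lattice only (the finite WINDOW system of a Tao-type averaged cascade); nothing here is a statement about the
Navier–Stokes equations; no item is closed; nothing numerical is asserted.

* `OneShiftFrame.abs_field_le_finFv` — on the final hull `Hs_S` every realisation's field is bounded by the order-1 jet
  `finFv` (part XLVIa) in every coordinate;
* `OneShiftFrame.abs_run_time_sub_le_of_gridCE` — the window run of an admissible point is `|finFv_c|`-Lipschitz in time on
  `[t_S, τ̂ + r_τ]` (mean value theorem; the run stays in `Hs_S` by part LXIV);
* `OneShiftFrame.abs_runAt_sub_le_of_gridCE` — two `AdmLip` points read at their OWN flight times: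
  `|x_u(τ_u)_c − x_v(τ_v)_c| ≤ (|finFv_c| r_τ + (pY_S + ZY_S)_c) dist + (pT_S + ZT_S)_c max B E`;
* **`OneShiftFrame.hZedge_of_gridCE`** — the clause `hZedge` of `T4W76R.ClausesFor` & co. for the CONSTRUCTED certificate from
  finite comparisons (`|finFv| r_τ + pY + ZY ≤ dz`, `pT + ZT ≤ χ_b, χ_e` at shell `0`); the clause `hγedge` follows in part LXXIb.
-/

noncomputable section

-- the sub-problem namespace repeats the summit name by design (D-0017)
set_option linter.dupNamespace false

namespace Summit.NavierStokesRegularity.NavierStokesRegularity.Theorems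

namespace DSSOneShift

open Set Finset Metric Filter Topology TopologicalSpace
open Literature.Analysis.ODE Literature.Analysis.FluidPDE Literature.Analysis.FluidPDE.TaoCascade
open Summit.NavierStokesRegularity.NavierStokesRegularity.Theorems.TaylorModelCert
open Summit.NavierStokesRegularity.NavierStokesRegularity.Theorems.TaylorModelReadout
open Summit.NavierStokesRegularity.NavierStokesRegularity.Theorems.CertificateGlueOn

variable {m : ℕ}

namespace OneShiftFrame

variable (F : OneShiftFrame m)

section Glue

variable {ε₀ : ℝ} {α : Fin m → Fin m → Fin m → ℤ × ℤ × ℤ → ℝ} {R : ℤ → ℝ}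
variable {g : GridCD} {kd : KrawD} {e : F.SIdx ≃ Fin g.n}

/-! ### The field on the final hull and the time-Lipschitz bound of a run -/

/-- **On the final hull every realisation's field is bounded by the order-1 interval jet `finFv`** (part XLVIa), in
every flat coordinate, at every time of the final step. [cite: Moore1979, §3.4 eq. (3.14) and §3.2; cell vocabulary, harvest/h2-tao-ladder rung1/KERNEL-CHEAP-REPLAY-SPEC.md §9 (G) (f-hull)] -/
theorem abs_field_le_finFv (M : F.FrameMatch g.toGridD kd e R)
    (Tc : ℕ → F.TIdx → BTerm F.SIdx) (rows : F.SIdx → List F.TIdx)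
    (hRD : ∀ u : F.Space, ∀ s ≤ g.S, ∀ r ∈ Ico 0 (g.h s).toReal,
      IsRTEncl (g.es e M.hn s) (Tc s) (F.wterms ε₀ α (F.preclampTail u) (g.t s + r)) rows (g.step s).RD)
    (hstep : ∀ s ≤ g.S, g.stepOK s = true) (u : F.Space) {θ : ℝ} (hθ : θ ∈ Icc (g.t g.S) F.τhi)
    {x : F.SIdx → ℝ} (hx : x ∈ boxSet (boxOf e (g.step g.S).Hs)) (c : F.SIdx) :
    |termField (F.wterms ε₀ α (F.preclampTail u) θ) x c| ≤ (IntervalD.mag (IntervalD.aget g.finFv (e c))).toReal := by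
  classical
  have hn := M.hn
  have hchkS : (g.step g.S).check = true := by
    have := hstep g.S le_rfl
    simp only [GridD.stepOK, Bool.and_eq_true, decide_eq_true_eq] at this
    exact this.1
  have hc' : (g.step g.S).toRoughStepD.check = true ∧ (g.step g.S).checkPair = true := by
    simpa [PairStepD.check, Bool.and_eq_true] using hchkS
  have hrc' : (g.step g.S).toRoughStepD.centre.check = true ∧ (g.step g.S).toRoughStepD.checkKZ = true := by
    simpa [RoughStepD.check, Bool.and_eq_true] using hc'.1
  obtain ⟨heta, hKZ⟩ := (g.step g.S).toRoughStepD.of_checkKZ hrc'.2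
  have hcw := (g.step g.S).toRoughStepD.centre.of_checkWith (by rw [← CentreStepD.check_eq]; exact hrc'.1)
  have hwfS : ∀ c < (g.step g.S).n, wfsD (IntervalD.aget (g.step g.S).S c) = true := fun c hc => (hcw.2.2.1 c hc).2.1
  have hZ : ∀ c < (g.step g.S).n, 0 ≤ (RoughStepD.dget (g.step g.S).Zh c).toReal := fun c hc => (hKZ c hc).1
  have hwfH : ∀ c < (g.step g.S).n, wfD (IntervalD.aget (g.step g.S).Hs c) = true := fun c hc =>
    (Dyad.ble_iff _ _).2 ((g.step g.S).toRoughStepD.wf_Hs hwfS hZ heta hc)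
  have hr : θ - g.t g.S ∈ Ico 0 (g.h g.S).toReal := ⟨by linarith [hθ.1], by linarith [hθ.2, M.hTS]⟩
  have hRDS := hRD u g.S le_rfl (θ - g.t g.S) hr
  rw [show g.t g.S + (θ - g.t g.S) = θ by ring] at hRDS
  have hSQ := isSQEnclosure_sqR (g.es e hn g.S) hRDS (g.step g.S).prec
  have hx' : x ∈ boxSet (boxOf (g.es e hn g.S) (g.step g.S).Hs) := by rw [GridD.boxOf_es]; exact hx
  have hHB := (g.step g.S).toRoughStepD.centre.hboxMem_of_mem_boxOf (g.es e hn g.S) hwfH hx'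
  have hcn : (e c : ℕ) < (g.step g.S).n := by rw [hn]; exact (e c).isLt
  have hmem := mem_tjet_of_jetLevelsA (F.wterms ε₀ α (F.preclampTail u) θ) (g.es e hn g.S) hSQ (g.step g.S).prec 1
    ((g.step g.S).toRoughStepD.centre.size_ext (g.step g.S).Hs) hHB (k := 1) le_rfl hcn
  have hsymm : (g.es e hn g.S).symm ⟨(e c : ℕ), hcn⟩ = c := (g.es e hn g.S).symm_apply_eq.2 (Fin.ext (by simp))
  rw [hsymm, tjet_one] at hmem
  exact IntervalD.abs_le_mag hmem

/-- **The window run of an admissible point is `|finFv_c|`-Lipschitz in time on the final step** `[t_S, τ̂ + r_τ]`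
(mean value theorem; the run stays in the final hull by part LXIV). [cite: Moore1979, §8.1 eq. (8.13); KapelaZgliczynski2009, §4 Lemma 4.1; cell vocabulary, harvest/h2-tao-ladder rung1/RUNG1-P2G9-REPORT.md §37 (hZedge: dz)] -/
theorem abs_run_time_sub_le_of_gridCE (hε : 0 ≤ ε₀) (hα : IsCancellingCoeff α)
    (hEb : ∀ i, |F.tubeC i (-1)| + F.tubeR (-1) ≤ F.Eb) (hEt : ∀ i, |F.tubeC i F.W| + F.tubeR F.W ≤ F.Et)
    (M : F.FrameMatch g.toGridD kd e R)
    (Tc : ℕ → F.TIdx → BTerm F.SIdx) (rows : F.SIdx → List F.TIdx)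
    (hRDc : ∀ s ≤ g.S, IsRTEncl (g.es e M.hn s) (Tc s) (Tc s) rows (g.step s).RD)
    (hRD : ∀ u : F.Space, ∀ s ≤ g.S, ∀ r ∈ Ico 0 (g.h s).toReal,
      IsRTEncl (g.es e M.hn s) (Tc s) (F.wterms ε₀ α (F.preclampTail u) (g.t s + r)) rows (g.step s).RD)
    (hstep : ∀ s ≤ g.S, g.stepOK s = true) (hinit : g.initOK = true) (hprod : ∀ s < g.S, g.prodOKE s = true)
    (hpwf : ∀ s ≤ g.S, g.pwfOK s = true) (hpsub : ∀ s ≤ g.S, g.psubOK s = true)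
    (hplink : ∀ s < g.S, g.plinkOK s = true) (hwlink : ∀ s < g.S, g.wlinkOK s = true)
    (hP0 : (fun c : F.SIdx => F.yc c.1 ((c.2 : ℕ) : ℤ)) ∈ boxSet (boxOf e (g.P 0)))
    {u : F.Space} (hu : F.AdmLip R u) {τ τ' : ℝ} (hτ : τ ∈ Icc (g.t g.S) F.τhi) (hτ' : τ' ∈ Icc (g.t g.S) F.τhi)
    (c : F.SIdx) :
    |F.flatRun (F.windowRunMap ε₀ α (F.preclampY u) (F.preclampTail u)) τ c -
      F.flatRun (F.windowRunMap ε₀ α (F.preclampY u) (F.preclampTail u)) τ' c| ≤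
      (IntervalD.mag (IntervalD.aget g.finFv (e c))).toReal * |τ - τ'| := by
  classical
  have hW1 := M.hW1
  have hn := M.hn
  have hW : 0 < F.W := lt_trans zero_lt_one hW1
  set Swu := F.windowRunMap ε₀ α (F.preclampY u) (F.preclampTail u) with hSwudef
  have hSwu : F.IsRunFrom ε₀ α (F.preclampY u) (F.preclampTail u) Swu := F.isRunFrom_windowRunMap hε hW hα hEb hEt hu.1
  have hfu : ∀ t ∈ Icc 0 F.τhi, HasDerivWithinAt (F.flatRun Swu)
      (termField (F.wterms ε₀ α (F.preclampTail u) t) (F.flatRun Swu t)) (Icc 0 F.τhi) t := by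
    intro t ht
    have h := F.hasDerivWithinAt_flatRun hSwu ht
    rwa [F.wfieldFlat_eq_termField] at h
  set Scu := F.windowRunMap ε₀ α (F.preclampY (F.zeroWin u)) (F.preclampTail (F.zeroWin u)) with hScudef
  have hScu : F.IsRunFrom ε₀ α (F.preclampY (F.zeroWin u)) (F.preclampTail (F.zeroWin u)) Scu :=
    F.isRunFrom_windowRunMap hε hW hα hEb hEt (F.adm_zeroWin hu.1)
  have hfcu : ∀ t ∈ Icc 0 F.τhi, HasDerivWithinAt (F.flatRun Scu)
      (termField (F.wterms ε₀ α (F.preclampTail u) t) (F.flatRun Scu t)) (Icc 0 F.τhi) t := by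
    intro t ht
    have h := F.hasDerivWithinAt_flatRun hScu ht
    rwa [F.preclampTail_zeroWin, F.wfieldFlat_eq_termField] at h
  have hScu0 : F.flatRun Scu 0 = fun c : F.SIdx => F.yc c.1 ((c.2 : ℕ) : ℤ) := funext fun c => F.flatRun_zeroWin_zero hScu c
  have hau : F.flatRun Swu 0 ∈ boxSet (boxOf e (g.step 0).W) := M.hW0 _ fun c => F.abs_flatRun_zero_sub_yc_le hSwu c
  have hτc := F.τc_gt
  have hrτ := F.rτ_pos
  have htS' : g.t g.S ≤ F.τhi := M.htS.trans (by unfold τhi; linarith)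
  have hTS' : F.τhi ≤ g.t g.S + (g.h g.S).toReal := M.hTS.le
  have hHu := g.traj_mem_Hs_of_gridCE e hn hRDc (hRD u) hstep hinit hprod hpwf hpsub hplink hwlink htS' hP0 hScu0 hfcu
    hau rfl hfu
  have hh : ∀ s ≤ g.S, 0 ≤ (g.h s).toReal := fun s hs => (g.h_nonneg_and_wfW (hstep s hs)).1
  have ht0 : 0 ≤ g.t g.S := g.t_nonneg fun k hk => hh k (by omega)
  have hsub : Icc (g.t g.S) F.τhi ⊆ Icc 0 F.τhi := Icc_subset_Icc_left ht0
  have hderiv : ∀ x ∈ Icc (g.t g.S) F.τhi, HasDerivWithinAt (fun t => F.flatRun Swu t c)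
      (termField (F.wterms ε₀ α (F.preclampTail u) x) (F.flatRun Swu x) c) (Icc (g.t g.S) F.τhi) x :=
    fun x hx => ((hasDerivWithinAt_pi.1 (hfu x (hsub hx))) c).mono hsub
  have hbound : ∀ x ∈ Icc (g.t g.S) F.τhi, ‖termField (F.wterms ε₀ α (F.preclampTail u) x) (F.flatRun Swu x) c‖ ≤
      (IntervalD.mag (IntervalD.aget g.finFv (e c))).toReal := fun x hx => by
    rw [Real.norm_eq_abs]
    exact F.abs_field_le_finFv M Tc rows hRD hstep u hx (hHu g.S le_rfl x hx (hx.2.trans hTS')) c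
  have h := (convex_Icc (g.t g.S) F.τhi).norm_image_sub_le_of_norm_hasDerivWithin_le hderiv hbound hτ' hτ
  rw [Real.norm_eq_abs, Real.norm_eq_abs] at h
  exact h

/-! ### Two points read at their own flight times -/

/-- **TWO ADMISSIBLE POINTS READ AT THEIR OWN FLIGHT TIMES**: with the hypotheses of part LXX
`abs_run_sub_le_of_gridCE`, for `AdmLip` points `u, v` with wake / top tails within `B` / `E`:
`|x_u(τ_u)_c − x_v(τ_v)_c| ≤ (|finFv_c| · r_τ + (pY_S + ZY_S)_c) · dist(u,v) + (pT_S + ZT_S)_c · max B E`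
(`τ_u, τ_v` the decoded flight times; time part by `abs_run_time_sub_le_of_gridCE`, state part by part LXX on the final step).
[cite: Tao2016AveragedNS, §5.3; KapelaZgliczynski2009, §4 Lemma 8 / Thm. 9; cell vocabulary, harvest/h2-tao-ladder rung1/RUNG1-P2G9-REPORT.md §37 (hZedge), rung1/RUNG1-P2G16-REPORT.md §83] -/
theorem abs_runAt_sub_le_of_gridCE (hε : 0 ≤ ε₀) (hα : IsCancellingCoeff α)
    (hEb : ∀ i, |F.tubeC i (-1)| + F.tubeR (-1) ≤ F.Eb) (hEt : ∀ i, |F.tubeC i F.W| + F.tubeR F.W ≤ F.Et)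
    (M : F.FrameMatch g.toGridD kd e R)
    (Tc : ℕ → F.TIdx → BTerm F.SIdx) (rows : F.SIdx → List F.TIdx)
    (hRDc : ∀ s ≤ g.S, IsRTEncl (g.es e M.hn s) (Tc s) (Tc s) rows (g.step s).RD)
    (hRD : ∀ u : F.Space, ∀ s ≤ g.S, ∀ r ∈ Ico 0 (g.h s).toReal,
      IsRTEncl (g.es e M.hn s) (Tc s) (F.wterms ε₀ α (F.preclampTail u) (g.t s + r)) rows (g.step s).RD)
    (hstep : ∀ s ≤ g.S, g.stepOK s = true) (hinit : g.initOK = true) (hprod : ∀ s < g.S, g.prodOKE s = true)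
    (hpwf : ∀ s ≤ g.S, g.pwfOK s = true) (hpsub : ∀ s ≤ g.S, g.psubOK s = true)
    (hplink : ∀ s < g.S, g.plinkOK s = true) (hwlink : ∀ s < g.S, g.wlinkOK s = true)
    (hP0 : (fun c : F.SIdx => F.yc c.1 ((c.2 : ℕ) : ℤ)) ∈ boxSet (boxOf e (g.P 0)))
    (sd : SensD) (hsens : ∀ s ≤ g.S, g.sensStepOK sd s = true) (hlink : ∀ s < g.S, g.sensLinkOK sd s = true)
    (ha0 : ∀ c : F.SIdx, F.a c.1 ((c.2 : ℕ) : ℤ) ≤ (sd.pYf 0 (e c)).toReal)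
    {u v : F.Space} (hu : F.AdmLip R u) (hv : F.AdmLip R v) {B E : ℝ}
    (hB : ∀ i, ∀ t ∈ Icc 0 F.τhi, |F.decodeTail u i (-1) t - F.decodeTail v i (-1) t| ≤ B)
    (hE : ∀ i, ∀ t ∈ Icc 0 F.τhi, |F.decodeTail u i F.W t - F.decodeTail v i F.W t| ≤ E) (c : F.SIdx) :
    |F.flatRun (F.windowRunMap ε₀ α (F.preclampY u) (F.preclampTail u)) (F.decodeTau u) c -
      F.flatRun (F.windowRunMap ε₀ α (F.preclampY v) (F.preclampTail v)) (F.decodeTau v) c| ≤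
      ((IntervalD.mag (IntervalD.aget g.finFv (e c))).toReal * F.rτ +
        ((sd.pYf g.S (e c)).toReal + (sd.ZYf g.S (e c)).toReal)) * dist u v +
      ((sd.pTf g.S (e c)).toReal + (sd.ZTf g.S (e c)).toReal) * max B E ∧
      0 ≤ (sd.pTf g.S (e c)).toReal + (sd.ZTf g.S (e c)).toReal := by
  classical
  have hτc := F.τc_gt
  have hrτ := F.rτ_pos
  have hTS' : F.τhi ≤ g.t g.S + (g.h g.S).toReal := M.hTS.le
  have hτu0 := F.decodeTau_mem_Icc hu.1
  have hτv0 := F.decodeTau_mem_Icc hv.1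
  have hτu : F.decodeTau u ∈ Icc (g.t g.S) F.τhi := ⟨M.htS.trans hτu0.1, hτu0.2⟩
  have hτv : F.decodeTau v ∈ Icc (g.t g.S) F.τhi := ⟨M.htS.trans hτv0.1, hτv0.2⟩
  have hdτ : |F.decodeTau u - F.decodeTau v| ≤ F.rτ * dist u v := F.abs_decodeTau_sub_le u v
  -- time part
  have h1 := F.abs_run_time_sub_le_of_gridCE hε hα hEb hEt M Tc rows hRDc hRD hstep hinit hprod hpwf hpsub hplink hwlink hP0
    hu hτu hτv c
  -- state part on the final step at the flight time of `v`
  obtain ⟨h2, hpT⟩ := F.abs_run_sub_le_of_gridCE hε hα hEb hEt M Tc rows hRDc hRD hstep hinit hprod hpwf hpsub hplink hwlink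
    hP0 sd hsens hlink hu hv hB hE dist_nonneg (F.start_diff_le_dist ha0 u v) g.S le_rfl (F.decodeTau v) hτv (hτv.2.trans hTS') c
  refine ⟨?_, hpT⟩
  have hFm : 0 ≤ (IntervalD.mag (IntervalD.aget g.finFv (e c))).toReal := by
    simp only [IntervalD.mag, Dyad.toReal_max, Dyad.toReal_abs]
    exact (abs_nonneg _).trans (le_max_left _ _)
  calc |F.flatRun (F.windowRunMap ε₀ α (F.preclampY u) (F.preclampTail u)) (F.decodeTau u) c -
        F.flatRun (F.windowRunMap ε₀ α (F.preclampY v) (F.preclampTail v)) (F.decodeTau v) c|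
      ≤ |F.flatRun (F.windowRunMap ε₀ α (F.preclampY u) (F.preclampTail u)) (F.decodeTau u) c -
          F.flatRun (F.windowRunMap ε₀ α (F.preclampY u) (F.preclampTail u)) (F.decodeTau v) c| +
        |F.flatRun (F.windowRunMap ε₀ α (F.preclampY u) (F.preclampTail u)) (F.decodeTau v) c -
          F.flatRun (F.windowRunMap ε₀ α (F.preclampY v) (F.preclampTail v)) (F.decodeTau v) c| := abs_sub_le _ _ _
    _ ≤ (IntervalD.mag (IntervalD.aget g.finFv (e c))).toReal * |F.decodeTau u - F.decodeTau v| +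
        (((sd.pYf g.S (e c)).toReal + (sd.ZYf g.S (e c)).toReal) * dist u v +
          ((sd.pTf g.S (e c)).toReal + (sd.ZTf g.S (e c)).toReal) * max B E) := add_le_add h1 h2
    _ ≤ (IntervalD.mag (IntervalD.aget g.finFv (e c))).toReal * (F.rτ * dist u v) +
        (((sd.pYf g.S (e c)).toReal + (sd.ZYf g.S (e c)).toReal) * dist u v +
          ((sd.pTf g.S (e c)).toReal + (sd.ZTf g.S (e c)).toReal) * max B E) := by gcongr
    _ = _ := by ring

/-! ### The clause `hZedge` -/

/-- **THE LEFT-BEHIND-SHELL CLAUSE `hZedge` FROM THE CENTRED GRID AND THE SENSITIVITY CHAIN**: with the hypotheses of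
part LXX and the finite comparisons `|finFv_(i,0)| r_τ + (pY_S + ZY_S)_(i,0) ≤ dz`, `(pT_S + ZT_S)_(i,0) ≤ χ_b`, `≤ χ_e` for
every mode `i`: for every two `AdmLip` points and all edge bounds `B, E`,
`|x_u,i,0(τ_u) − x_v,i,0(τ_v)| ≤ dz · dist(u,v) + χ_b · B + χ_e · E` — the clause `hZedge` of `T4W76R.ClausesFor` & co.
for the CONSTRUCTED certificate. [cite: Tao2016AveragedNS, §4, §5.3; KapelaZgliczynski2009, §4 Lemma 8 / Thm. 9; cell vocabulary, harvest/h2-tao-ladder rung1/RUNG1-P2G9-REPORT.md §37 (hZedge), rung1/RUNG1-P2G16-REPORT.md §83] -/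
theorem hZedge_of_gridCE (hε : 0 ≤ ε₀) (hα : IsCancellingCoeff α)
    (hEb : ∀ i, |F.tubeC i (-1)| + F.tubeR (-1) ≤ F.Eb) (hEt : ∀ i, |F.tubeC i F.W| + F.tubeR F.W ≤ F.Et)
    (M : F.FrameMatch g.toGridD kd e R)
    (Tc : ℕ → F.TIdx → BTerm F.SIdx) (rows : F.SIdx → List F.TIdx)
    (hRDc : ∀ s ≤ g.S, IsRTEncl (g.es e M.hn s) (Tc s) (Tc s) rows (g.step s).RD)
    (hRD : ∀ u : F.Space, ∀ s ≤ g.S, ∀ r ∈ Ico 0 (g.h s).toReal,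
      IsRTEncl (g.es e M.hn s) (Tc s) (F.wterms ε₀ α (F.preclampTail u) (g.t s + r)) rows (g.step s).RD)
    (hstep : ∀ s ≤ g.S, g.stepOK s = true) (hinit : g.initOK = true) (hprod : ∀ s < g.S, g.prodOKE s = true)
    (hpwf : ∀ s ≤ g.S, g.pwfOK s = true) (hpsub : ∀ s ≤ g.S, g.psubOK s = true)
    (hplink : ∀ s < g.S, g.plinkOK s = true) (hwlink : ∀ s < g.S, g.wlinkOK s = true)
    (hP0 : (fun c : F.SIdx => F.yc c.1 ((c.2 : ℕ) : ℤ)) ∈ boxSet (boxOf e (g.P 0)))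
    (sd : SensD) (hsens : ∀ s ≤ g.S, g.sensStepOK sd s = true) (hlink : ∀ s < g.S, g.sensLinkOK sd s = true)
    (ha0 : ∀ c : F.SIdx, F.a c.1 ((c.2 : ℕ) : ℤ) ≤ (sd.pYf 0 (e c)).toReal)
    (dz χb χe : ℝ)
    (hcmp : ∀ i : Fin m,
      (IntervalD.mag (IntervalD.aget g.finFv (e (i, ⟨0, lt_trans zero_lt_one M.hW1⟩)))).toReal * F.rτ +
        ((sd.pYf g.S (e (i, ⟨0, lt_trans zero_lt_one M.hW1⟩))).toReal +
          (sd.ZYf g.S (e (i, ⟨0, lt_trans zero_lt_one M.hW1⟩))).toReal) ≤ dz ∧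
      (sd.pTf g.S (e (i, ⟨0, lt_trans zero_lt_one M.hW1⟩))).toReal +
        (sd.ZTf g.S (e (i, ⟨0, lt_trans zero_lt_one M.hW1⟩))).toReal ≤ χb ∧
      (sd.pTf g.S (e (i, ⟨0, lt_trans zero_lt_one M.hW1⟩))).toReal +
        (sd.ZTf g.S (e (i, ⟨0, lt_trans zero_lt_one M.hW1⟩))).toReal ≤ χe)
    (C : F.WState × ℝ → F.WState × ℝ) (hC : ∀ r, C r = 0 → r = 0) :
    ∀ u v, F.AdmLip R u → F.AdmLip R v → ∀ i, ∀ B E : ℝ,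
      (∀ i, ∀ t ∈ Icc 0 F.τhi, |F.decodeTail u i (-1) t - F.decodeTail v i (-1) t| ≤ B) →
      (∀ i, ∀ t ∈ Icc 0 F.τhi, |F.decodeTail u i F.W t - F.decodeTail v i F.W t| ≤ E) →
      |F.fullFamily (F.windowCertOfMatrix hε (lt_trans zero_lt_one M.hW1) hα hEb hEt C hC) u i 0 (F.decodeTau u) -
        F.fullFamily (F.windowCertOfMatrix hε (lt_trans zero_lt_one M.hW1) hα hEb hEt C hC) v i 0 (F.decodeTau v)| ≤
      dz * dist u v + χb * B + χe * E := by
  classical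
  intro u v hu hv i B E hB hE
  have hW1 := M.hW1
  set j0 : Fin F.W := ⟨0, lt_trans zero_lt_one M.hW1⟩ with hj0
  have ht0' : (0 : ℝ) ∈ Icc 0 F.τhi := ⟨le_rfl, F.τhi_pos.le⟩
  have hB0 : 0 ≤ B := (abs_nonneg _).trans (hB i 0 ht0')
  have hE0 : 0 ≤ E := (abs_nonneg _).trans (hE i 0 ht0')
  have hδBE : max B E ≤ B + E := max_le (by linarith) (by linarith)
  obtain ⟨hc, hpT⟩ := F.abs_runAt_sub_le_of_gridCE hε hα hEb hEt M Tc rows hRDc hRD hstep hinit hprod hpwf hpsub hplink hwlink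
    hP0 sd hsens hlink ha0 hu hv hB hE (i, j0)
  have hvalu : F.flatRun (F.windowRunMap ε₀ α (F.preclampY u) (F.preclampTail u)) (F.decodeTau u) (i, j0) =
      F.fullFamily (F.windowCertOfMatrix hε (lt_trans zero_lt_one M.hW1) hα hEb hEt C hC) u i 0 (F.decodeTau u) := by
    simp only [flatRun, hj0]; rfl
  have hvalv : F.flatRun (F.windowRunMap ε₀ α (F.preclampY v) (F.preclampTail v)) (F.decodeTau v) (i, j0) =
      F.fullFamily (F.windowCertOfMatrix hε (lt_trans zero_lt_one M.hW1) hα hEb hEt C hC) v i 0 (F.decodeTau v) := by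
    simp only [flatRun, hj0]; rfl
  rw [hvalu, hvalv] at hc
  obtain ⟨h1, h2, h3⟩ := hcmp i
  have hd := dist_nonneg (x := u) (y := v)
  refine hc.trans ?_
  calc ((IntervalD.mag (IntervalD.aget g.finFv (e (i, j0)))).toReal * F.rτ +
        ((sd.pYf g.S (e (i, j0))).toReal + (sd.ZYf g.S (e (i, j0))).toReal)) * dist u v +
        ((sd.pTf g.S (e (i, j0))).toReal + (sd.ZTf g.S (e (i, j0))).toReal) * max B E
      ≤ dz * dist u v + ((sd.pTf g.S (e (i, j0))).toReal + (sd.ZTf g.S (e (i, j0))).toReal) * (B + E) := by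
        gcongr
    _ = dz * dist u v + ((sd.pTf g.S (e (i, j0))).toReal + (sd.ZTf g.S (e (i, j0))).toReal) * B +
        ((sd.pTf g.S (e (i, j0))).toReal + (sd.ZTf g.S (e (i, j0))).toReal) * E := by ring
    _ ≤ dz * dist u v + χb * B + χe * E := by gcongr

end Glue

end OneShiftFrame

end DSSOneShift

end Summit.NavierStokesRegularity.NavierStokesRegularity.Theorems
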